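import Literature.Claims.NS.Wu2026
import Literature.Analysis.Calculus.SmoothCutoff
import Literature.Analysis.FluidPDE.TaoEnstrophyLocalisationProofs
import Mathlib.Analysis.FunctionalSpaces.SobolevInequality
import Mathlib.MeasureTheory.Function.LpSpace.Complete
import HarnessLib

/-!
# C177 `Wu2026` — SALVAGE, TRUE column: the Sobolev embedding `v ∈ L⁶(ℝ³)` for decaying fields
# of finite Dirichlet energy (D-0090 NS-CLAIMS, LADDER row rung 3; salvage seat `ns-claims-salvage-p3`)

First helper toward the binder `Literature.Claims.NS.Wu2026.Step_382` (the harmonic cut-off energy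
inequality (3.72)–(3.82), p.23–25): the absolute convergence of the physical current
`R∫_{|x|>R} 𝒬 v·x/|x|³` ((3.73)–(3.74)) and the vanishing of the truncation errors in (3.81) → (3.82)
need an integrability of `v` at infinity that the binder's hypotheses (`IsWuFlow`, `D(v) < ∞`) carry
only through the Sobolev embedding. This file proves it in the kernel, for every `C¹` field
`v : ℝ³ → ℝ³` with `v → 0` at infinity:

* `exists_eLpNorm_six_le_dirichlet` — `‖v‖_{L⁶} ≤ C · D(v)^{1/2}` with one constant `C`
  (Mathlib's Gagliardo–Nirenberg–Sobolev inequality `eLpNorm_le_eLpNorm_fderiv_of_eq`, `p = 2`,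
  `p* = 6`, applied to the compactly supported RANGE truncations
  `u_δ = ψ((3δ²)⁻¹|v|² − 1/3)·v`, `ψ = Real.smoothTransition`, whose derivative is bounded by
  `(1 + 3 sup|ψ'|)‖∇v‖` pointwise (`norm_fderiv_rangeTrunc_le`), then Fatou
  `MeasureTheory.Lp.eLpNorm_lim_le_liminf_eLpNorm` as `δ = 1/(n+1) → 0`);
* `memLp_six_of_dirichlet_lt_top` — hence `D(v) < ∞ ⇒ v ∈ L⁶`;
* `eLpNorm_fderiv_two_le_dirichlet_sqrt` — `‖∇v‖_{L²} ≤ D(v)^{1/2}` (operator vs Frobenius norm).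

Theorems only, standard axioms. Companions: `SoloSalvageWu2026{,Flux,Annulus,LogMass,Reduced,Energy}.lean`.

WHAT THIS IS NOT: not a claim about NS regularity or blow-up; not a claim about any author beyond the
typed locator.
-/

set_option linter.dupNamespace false

noncomputable section

open MeasureTheory Set Filter Topology Module
open scoped ENNReal NNReal Topology RealInnerProductSpace

namespace Summit.NavierStokesRegularity.NavierStokesRegularity.Theorems.Wu2026Salvage

open Literature.Analysis.FluidPDE Literature.Claims.NS.Wu2026

/-- `‖Dv‖_{L²} ≤ D(v)^{1/2}`: the `L²` norm of the derivative (operator norm) is dominated by the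
Dirichlet energy (Frobenius norm). [folklore] -/
theorem eLpNorm_fderiv_two_le_dirichlet_sqrt (v : E3 → E3) :
    eLpNorm (fderiv ℝ v) 2 volume ≤ dirichlet v ^ (1 / 2 : ℝ) := by
  unfold dirichlet
  rw [eLpNorm_eq_lintegral_rpow_enorm_toReal two_ne_zero ENNReal.ofNat_ne_top,
    ENNReal.toReal_ofNat]
  gcongr with x
  rw [show (2 : ℝ) = ((2 : ℕ) : ℝ) by norm_num, ENNReal.rpow_natCast, ← ofReal_norm,
    ← ENNReal.ofReal_pow (norm_nonneg _)]
  exact ENNReal.ofReal_le_ofReal (sq_opNorm_le_frobeniusNormSq _)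

/-- The range truncations `u_δ = ψ((3δ²)⁻¹|v|² − 1/3)·v` (`ψ` = `Real.smoothTransition`, so
`u_δ = 0` where `|v| ≤ δ` and `u_δ = v` where `|v| ≥ 2δ`) of a `C¹` field: `C¹`, and
`‖Du_δ‖ ≤ (1 + 3M)‖Dv‖` pointwise, `M` a bound for `|ψ'|`. [folklore] -/
theorem norm_fderiv_rangeTrunc_le {M : ℝ} (hM0 : 0 ≤ M)
    (hM : ∀ t, |deriv Real.smoothTransition t| ≤ M) {v : E3 → E3} (hv : ContDiff ℝ 1 v)
    {δ : ℝ} (hδ : 0 < δ) (x : E3) :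
    ‖fderiv ℝ (fun y => Real.smoothTransition ((3 * δ ^ 2)⁻¹ * ‖v y‖ ^ 2 - 3⁻¹) • v y) x‖ ≤
      (1 + 3 * M) * ‖fderiv ℝ v x‖ := by
  set a : E3 → ℝ := fun y => (3 * δ ^ 2)⁻¹ * ‖v y‖ ^ 2 - 3⁻¹ with ha
  have hvd : HasFDerivAt v (fderiv ℝ v x) x :=
    (hv.differentiable one_ne_zero x).hasFDerivAt
  have had : HasFDerivAt a ((3 * δ ^ 2)⁻¹ • (2 • (innerSL ℝ (v x)).comp (fderiv ℝ v x))) x := by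
    have := (hvd.norm_sq.const_mul ((3 * δ ^ 2)⁻¹)).sub_const (3⁻¹ : ℝ)
    simpa [ha] using this
  have hψd : HasDerivAt Real.smoothTransition (deriv Real.smoothTransition (a x)) (a x) :=
    (Literature.Analysis.Calculus.differentiable_smoothTransition (a x)).hasDerivAt
  have hcomp : HasFDerivAt (fun y => Real.smoothTransition (a y))
      (deriv Real.smoothTransition (a x) • ((3 * δ ^ 2)⁻¹ •
        (2 • (innerSL ℝ (v x)).comp (fderiv ℝ v x)))) x :=
    hψd.comp_hasFDerivAt x had
  have hu : HasFDerivAt (fun y => Real.smoothTransition ((3 * δ ^ 2)⁻¹ * ‖v y‖ ^ 2 - 3⁻¹) • v y)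
      (Real.smoothTransition (a x) • fderiv ℝ v x +
        (deriv Real.smoothTransition (a x) • ((3 * δ ^ 2)⁻¹ •
          (2 • (innerSL ℝ (v x)).comp (fderiv ℝ v x)))).smulRight (v x)) x :=
    hcomp.smul hvd
  rw [hu.fderiv]
  have hδ2 : 0 < 3 * δ ^ 2 := by positivity
  set L : E3 →L[ℝ] ℝ := (innerSL ℝ (v x)).comp (fderiv ℝ v x) with hL
  have hLn : ‖L‖ ≤ ‖v x‖ * ‖fderiv ℝ v x‖ :=
    (ContinuousLinearMap.opNorm_comp_le _ _).trans (by rw [innerSL_apply_norm])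
  have hA : ‖Real.smoothTransition (a x) • fderiv ℝ v x‖ ≤ ‖fderiv ℝ v x‖ := by
    rw [norm_smul, Real.norm_eq_abs, abs_of_nonneg (Real.smoothTransition.nonneg _)]
    calc Real.smoothTransition (a x) * ‖fderiv ℝ v x‖ ≤ 1 * ‖fderiv ℝ v x‖ := by
          gcongr; exact Real.smoothTransition.le_one _
      _ = ‖fderiv ℝ v x‖ := one_mul _
  have hB : ‖(deriv Real.smoothTransition (a x) • ((3 * δ ^ 2)⁻¹ • (2 • L))).smulRight (v x)‖ ≤
      3 * M * ‖fderiv ℝ v x‖ := by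
    rw [ContinuousLinearMap.norm_smulRight_apply, norm_smul, norm_smul, Real.norm_eq_abs,
      Real.norm_eq_abs, abs_of_pos (inv_pos.2 hδ2)]
    by_cases hbig : 4 * δ ^ 2 < ‖v x‖ ^ 2
    · have h1a : 1 ≤ a x := by
        rw [ha]
        rw [le_sub_iff_add_le, ← div_eq_inv_mul, le_div_iff₀ hδ2]
        nlinarith
      rw [Literature.Analysis.Calculus.deriv_smoothTransition_of_one_le h1a]
      simp only [abs_zero, zero_mul]
      positivity
    · have hle : ‖v x‖ ^ 2 ≤ 4 * δ ^ 2 := not_lt.1 hbig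
      have h2L : ‖(2 : ℕ) • L‖ ≤ 2 * (‖v x‖ * ‖fderiv ℝ v x‖) :=
        norm_nsmul_le.trans (by push_cast; gcongr)
      calc |deriv Real.smoothTransition (a x)| * ((3 * δ ^ 2)⁻¹ * ‖(2 : ℕ) • L‖) * ‖v x‖
          ≤ M * ((3 * δ ^ 2)⁻¹ * (2 * (‖v x‖ * ‖fderiv ℝ v x‖))) * ‖v x‖ := by
            gcongr; exact hM _
        _ = (2 * M * ‖v x‖ ^ 2 / (3 * δ ^ 2)) * ‖fderiv ℝ v x‖ := by
            field_simp
        _ ≤ (2 * M * (4 * δ ^ 2) / (3 * δ ^ 2)) * ‖fderiv ℝ v x‖ := by gcongr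
        _ = (8 / 3 * M) * ‖fderiv ℝ v x‖ := by field_simp; ring
        _ ≤ 3 * M * ‖fderiv ℝ v x‖ := by gcongr; norm_num
  calc ‖Real.smoothTransition (a x) • fderiv ℝ v x +
        (deriv Real.smoothTransition (a x) • ((3 * δ ^ 2)⁻¹ • (2 • L))).smulRight (v x)‖
      ≤ ‖fderiv ℝ v x‖ + 3 * M * ‖fderiv ℝ v x‖ := (norm_add_le _ _).trans (add_le_add hA hB)
    _ = (1 + 3 * M) * ‖fderiv ℝ v x‖ := by ring

/-- The range truncation of a field decaying at infinity has compact support. [folklore] -/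
theorem hasCompactSupport_rangeTrunc {v : E3 → E3} (hdec : Tendsto v (cocompact E3) (𝓝 0))
    {δ : ℝ} (hδ : 0 < δ) :
    HasCompactSupport (fun y => Real.smoothTransition ((3 * δ ^ 2)⁻¹ * ‖v y‖ ^ 2 - 3⁻¹) • v y) := by
  have hev : ∀ᶠ y in cocompact E3, ‖v y‖ < δ := by
    have := (tendsto_nhds.1 (tendsto_norm.comp hdec))
    have h := hdec.norm
    rw [norm_zero] at h
    exact (tendsto_order.1 h).2 δ hδ
  obtain ⟨K, hK, hKv⟩ := mem_cocompact.1 hev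
  refine HasCompactSupport.intro hK fun y hy => ?_
  have hvy : ‖v y‖ < δ := hKv hy
  have ha : (3 * δ ^ 2)⁻¹ * ‖v y‖ ^ 2 - 3⁻¹ ≤ 0 := by
    have hδ2 : 0 < 3 * δ ^ 2 := by positivity
    rw [sub_nonpos, ← div_eq_inv_mul, div_le_iff₀ hδ2]
    have : ‖v y‖ ^ 2 < δ ^ 2 := by
      exact pow_lt_pow_left₀ hvy (norm_nonneg _) two_ne_zero
    nlinarith
  change Real.smoothTransition ((3 * δ ^ 2)⁻¹ * ‖v y‖ ^ 2 - 3⁻¹) • v y = 0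
  rw [Real.smoothTransition.zero_of_nonpos ha, zero_smul]

/-- The range truncation of a `C¹` field is `C¹`. [folklore] -/
theorem contDiff_rangeTrunc {v : E3 → E3} (hv : ContDiff ℝ 1 v) (δ : ℝ) :
    ContDiff ℝ 1 (fun y => Real.smoothTransition ((3 * δ ^ 2)⁻¹ * ‖v y‖ ^ 2 - 3⁻¹) • v y) := by
  exact (Real.smoothTransition.contDiff.comp
    ((contDiff_const.mul (hv.norm_sq ℝ)).sub contDiff_const)).smul hv

/-- **Sobolev embedding for decaying fields, `Ḣ¹ ∩ C₀ ⊂ L⁶` on `ℝ³`.** There is a constant `C`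
such that every `C¹` field `v : ℝ³ → ℝ³` tending to `0` at infinity satisfies
`‖v‖_{L⁶} ≤ C·D(v)^{1/2}`, `D(v) = ∫|∇v|²` (Gagliardo–Nirenberg–Sobolev for the compactly
supported range truncations `u_δ`, `‖∇u_δ‖ ≤ C‖∇v‖`, and Fatou as `δ → 0`). [folklore] -/
theorem exists_eLpNorm_six_le_dirichlet :
    ∃ C : ℝ≥0, ∀ v : E3 → E3, ContDiff ℝ 1 v → Tendsto v (cocompact E3) (𝓝 0) →
      eLpNorm v 6 volume ≤ C * dirichlet v ^ (1 / 2 : ℝ) := by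
  obtain ⟨M, hM0, hM⟩ := Literature.Analysis.Calculus.exists_bound_deriv_smoothTransition
  set CS : ℝ≥0 := SNormLESNormFDerivOfEqConst E3 (volume : Measure E3) 2 with hCS
  obtain ⟨K, hK⟩ : ∃ K : ℝ≥0, (K : ℝ) = 1 + 3 * M := ⟨⟨1 + 3 * M, by positivity⟩, rfl⟩
  refine ⟨CS * K, fun v hv hdec => ?_⟩
  -- the truncations
  set u : ℕ → E3 → E3 := fun n y =>
    Real.smoothTransition ((3 * ((n : ℝ) + 1)⁻¹ ^ 2)⁻¹ * ‖v y‖ ^ 2 - 3⁻¹) • v y with hu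
  have hδ : ∀ n : ℕ, (0 : ℝ) < ((n : ℝ) + 1)⁻¹ := fun n => by positivity
  have hn3 : 0 < finrank ℝ E3 := by simp
  have hp' : ((6 : ℝ≥0) : ℝ)⁻¹ = ((2 : ℝ≥0) : ℝ)⁻¹ - (finrank ℝ E3 : ℝ)⁻¹ := by
    simp [finrank_euclideanSpace]; norm_num
  have hbound : ∀ n, eLpNorm (u n) 6 volume ≤ ((CS * K : ℝ≥0) : ℝ≥0∞) * dirichlet v ^ (1 / 2 : ℝ) := by
    intro n
    have h1 : eLpNorm (u n) ((6 : ℝ≥0) : ℝ≥0∞) volume ≤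
        CS * eLpNorm (fderiv ℝ (u n)) ((2 : ℝ≥0) : ℝ≥0∞) volume :=
      eLpNorm_le_eLpNorm_fderiv_of_eq (μ := (volume : Measure E3)) (contDiff_rangeTrunc hv _)
        (hasCompactSupport_rangeTrunc hdec (hδ n)) (p := 2) (p' := 6) (by norm_num) hn3 hp'
    have h2 : eLpNorm (fderiv ℝ (u n)) 2 volume ≤ K • eLpNorm (fderiv ℝ v) 2 volume := by
      refine eLpNorm_le_nnreal_smul_eLpNorm_of_ae_le_mul (Eventually.of_forall fun x => ?_) 2
      have := norm_fderiv_rangeTrunc_le hM0 hM hv (hδ n) x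
      rw [← NNReal.coe_le_coe, NNReal.coe_mul, coe_nnnorm, coe_nnnorm, hK]
      simpa [hu] using this
    have h3 := eLpNorm_fderiv_two_le_dirichlet_sqrt v
    calc eLpNorm (u n) 6 volume ≤ CS * eLpNorm (fderiv ℝ (u n)) 2 volume := by simpa using h1
      _ ≤ CS * (K • eLpNorm (fderiv ℝ v) 2 volume) := by gcongr
      _ = CS * K * eLpNorm (fderiv ℝ v) 2 volume := by
          rw [ENNReal.smul_def, smul_eq_mul, mul_assoc]
      _ ≤ CS * K * dirichlet v ^ (1 / 2 : ℝ) := by gcongr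
      _ = _ := by rw [ENNReal.coe_mul]
  -- pointwise convergence `u n → v`
  have hlim : ∀ y, Tendsto (fun n => u n y) atTop (𝓝 (v y)) := by
    intro y
    by_cases hy : v y = 0
    · have : ∀ n, u n y = v y := fun n => by simp [hu, hy]
      simp_rw [this]; exact tendsto_const_nhds
    · have hpos : 0 < ‖v y‖ ^ 2 := by positivity
      -- eventually the argument of `ψ` is `≥ 1`
      have hev : ∀ᶠ n : ℕ in atTop, 1 ≤ (3 * ((n : ℝ) + 1)⁻¹ ^ 2)⁻¹ * ‖v y‖ ^ 2 - 3⁻¹ := by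
        have ht : Tendsto (fun n : ℕ => (3 * ((n : ℝ) + 1)⁻¹ ^ 2)⁻¹ * ‖v y‖ ^ 2 - 3⁻¹)
            atTop atTop := by
          have h0 : Tendsto (fun n : ℕ => ((n : ℝ) + 1)) atTop atTop :=
            tendsto_natCast_atTop_atTop.atTop_add tendsto_const_nhds
          have h1 : Tendsto (fun n : ℕ => (3 * ((n : ℝ) + 1)⁻¹ ^ 2)⁻¹) atTop atTop := by
            have : (fun n : ℕ => (3 * ((n : ℝ) + 1)⁻¹ ^ 2)⁻¹) =
                fun n : ℕ => 3⁻¹ * ((n : ℝ) + 1) ^ 2 := by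
              funext n; rw [mul_inv, inv_pow, inv_inv]
            rw [this]
            exact ((tendsto_pow_atTop two_ne_zero).comp h0).const_mul_atTop (by norm_num)
          have h2 := (h1.atTop_mul_const hpos).atTop_add (tendsto_const_nhds (x := -(3⁻¹ : ℝ)))
          simpa [sub_eq_add_neg] using h2
        exact ht.eventually_ge_atTop 1
      refine tendsto_nhds_of_eventually_eq (hev.mono fun n hn => ?_)
      simp only [hu]
      rw [Real.smoothTransition.one_of_one_le hn, one_smul]
  -- Fatou
  have hF := MeasureTheory.Lp.eLpNorm_lim_le_liminf_eLpNorm (μ := (volume : Measure E3)) (p := 6)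
    (fun n => (contDiff_rangeTrunc hv _).continuous.aestronglyMeasurable) v
    (Eventually.of_forall hlim)
  refine hF.trans (liminf_le_of_frequently_le' (Frequently.of_forall hbound))

/-- **`D(v) < ∞` and `v → 0` at infinity give `v ∈ L⁶(ℝ³)`** for `C¹` fields. [folklore] -/
theorem memLp_six_of_dirichlet_lt_top {v : E3 → E3} (hv : ContDiff ℝ 1 v)
    (hdec : Tendsto v (cocompact E3) (𝓝 0)) (hD : dirichlet v < ∞) : MemLp v 6 volume := by
  obtain ⟨C, hC⟩ := exists_eLpNorm_six_le_dirichlet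
  refine ⟨hv.continuous.aestronglyMeasurable, (hC v hv hdec).trans_lt ?_⟩
  exact ENNReal.mul_lt_top ENNReal.coe_lt_top (ENNReal.rpow_lt_top_of_nonneg (by norm_num) hD.ne)

end Summit.NavierStokesRegularity.NavierStokesRegularity.Theorems.Wu2026Salvage

-- WHAT THIS IS NOT: not a claim about NS regularity or blow-up; not a claim about any author beyond the typed locator.
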